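import Summits.QuantumFields.BalabanUV.T4Continuum.Support.NE9EndChainOn
import Summits.QuantumFields.BalabanUV.T4Continuum.Support.NE9SizeFedCouplingSpeciesReadOut

/-!
# NE9SizeFedCouplingSpeciesReadOutOn — LOCATED CORRECTION O-ne9p1g32-1 of the END's BOX BINDER, kernel part 3: THE END OF
# RECORD (T4, `NE9SizeFedCouplingSpeciesReadOut.termSize_ne9_and_fadingMemory_species_margProj_fedA3`, p216114) re-cut with the
# box read-out at ARISING tables (`hboxOn`) — the END the instancer applies
# (cell `pub-balaban`, T4-DAG §2 node U3 ∕ §6 NE9; BINDER row NE9 OWNER lineage `b2b-balaban-t4-ne9-p1`, generation 32;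
# sheet `t4/b2b-balaban-t4-ne9-p1/g32/TABLE-HALF-NE9-g32.md` §2 = finding OBJ-NE9-g32-1; parts 1–2 = `NE9BridgeSizeInductionOn`, `NE9EndChainOn`)

HONEST FRAMING (T4-DAG PAGE 1).  Rung (B)+1 of the FINITE-VOLUME T⁴ programme — NOT infinite volume, NOT a mass gap, NOT the
Clay problem.  NE9 (`T4OutputRate.NE9` ∧ `FadingMemory`) is a cell NEW ESTIMATE, NOT PRINTED in [I] = [Balaban1987RG1]
(CMP **109**), [II] = [Balaban1988RG2Cluster] (CMP **116**), NOT discharged here («NE9 ⇐ the named binders»; 0∕18 leaves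
instantiated on Bałaban's objects; spine PROVED 0∕9).  HONEST DEPENDENCY (cell line, verbatim): continuum YM on T⁴ ⇐ BetaPertH ∧
nine spine estimates (0/9 proved); BetaPertH ⇐ (D1) ∧ (D4) ∧ CAP+tail; G-an2-4 gates asym, D1 and NE2/3/4.  `FlowStep.BetaPertH`,
(B), (B^μ) do not occur.  Quotations for TYPES only (ABSOLUTE RULE).  0 sorry.

WHAT.  **`termSize_ne9_and_fadingMemory_species_margProj_fedA3_on`** — the END OF RECORD VERBATIM (hypothesis list = WALL-NE9-P1 §2)
but for the box read-out R1∕R2 binder: `hbox` (every table of the (1.36)-weighted box read into `𝒜 k`) ↦ **`hboxOn`** (only the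
ARISING tables `compProj (cpieceChannel D.toC + cpieceChannel K.toC) (margProj r A) k g′ (Ef g)`, `g, g′ ∈ W`).  Conclusion
LITERALLY the END of record's (`TermSize Ef W κ N ∧ NE9 Ef W κ Λ ∧ FadingMemory (ℓ∕ω′) ω′ Λ`, same letters).  Proof: the END of
record's own three-line proof with part 2's `termSize_ne9_and_fadingMemory_margProj_fed_on`.  The landed END is its corollary
(`NE9BridgeSizeInductionOn.hboxOn_of_hbox`).  WHY (sheet §2): the instancer's `ρ k` can be made total and weighted-1-Lipschitz
(`hρ`, generic: `NE9TableReading`) but can read the FULL box into an honest admissible set `𝒜 k` of a measure-theoretic activity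
only for arising (regular) tables — which is all the END uses.  DISGUISE TEST: a binder WEAKENED to its use; no estimate; not NE9.

References (TYPES only): [Balaban1987RG1] T. Bałaban, CMP **109** (1987) 249–301, (0.28)–(0.29) p. 258, (1.3) p. 260, (1.18)
p. 263, (1.20)–(1.22) p. 264, (3.53)–(3.54) p. 280, (4.22) p. 286; [Balaban1988RG2Cluster] T. Bałaban, CMP **116** (1988) 1–22,
(1.23)–(1.29) pp. 7–8, (1.33)–(1.36) p. 9, (2.14)–(2.15) p. 15.  Summits-side NEW work (LEAN PLACEMENT RULE); imports part 2 and the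
END of record's module BY NAME; modifies nothing.
-/

noncomputable section

namespace Summit.QuantumFields.BalabanUV.T4Continuum.NE9SizeFedCouplingSpeciesReadOutOn

open scoped BigOperators
open Metric Set
open Literature.Probability.LatticeModels
open Literature.MathematicalPhysics.QuantumFieldTheory.Balaban1983to89
open Literature.MathematicalPhysics.QuantumFieldTheory.Balaban1983to89.T4OutputRate
open Literature.MathematicalPhysics.QuantumFieldTheory.Balaban1983to89.T4HistoryLipschitzRecursion
open Literature.MathematicalPhysics.QuantumFieldTheory.Balaban1983to89.T4HistoryLipschitzOuter
open Literature.MathematicalPhysics.QuantumFieldTheory.Balaban1983to89.T4HistoryLipschitzActivity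
open Literature.MathematicalPhysics.QuantumFieldTheory.Balaban1983to89.T4HistoryLipschitzActivity (ClusterGeom)
open Literature.MathematicalPhysics.QuantumFieldTheory.Balaban1983to89.T4HistoryLipschitzSegment
open Summit.QuantumFields.BalabanUV.T4Continuum.NE9Lemma1Counting
open Summit.QuantumFields.BalabanUV.T4Continuum.NE9Lemma1Gain
open Summit.QuantumFields.BalabanUV.T4Continuum.NE9Lemma1PieceClass
open Summit.QuantumFields.BalabanUV.T4Continuum.NE9Lemma1RemainderSpecies
open Summit.QuantumFields.BalabanUV.T4Continuum.NE9Lemma1CurveSpecies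
open Summit.QuantumFields.BalabanUV.T4Continuum.NE9Lemma1KernelSpecies
open Summit.QuantumFields.BalabanUV.T4Continuum.NE9Lemma1RemainderSpeciesEnd (channelSizeAtStepNN_mono pieceAdditiveOn_mono)
open Summit.QuantumFields.BalabanUV.T4Continuum.NE9Lemma1SpeciesEnd (profile_species)
open Summit.QuantumFields.BalabanUV.T4Continuum.NE9ComplexEncoding (doubleCarriers)
open Summit.QuantumFields.BalabanUV.T4Continuum.NE9MarginalProjection
open Summit.QuantumFields.BalabanUV.T4Continuum.NE9MarginalProjectionEnd
open Summit.QuantumFields.BalabanUV.T4Continuum.NE9ChannelSum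
open Summit.QuantumFields.BalabanUV.T4Continuum.NE9SizeFedCoupling
open Summit.QuantumFields.BalabanUV.T4Continuum.NE9SizeFedCouplingSpecies (tcup_species_proj)

open Summit.QuantumFields.BalabanUV.T4Continuum.NE9EndChainOn

section Species

variable {C₀ : Carriers} {E : Type} [NormedAddCommGroup E] [NormedSpace ℂ E]
  {ι α β γ δ α' β' γ' δ' Pt : Type} [DecidableEq δ] [DecidableEq δ']

/-! ## The READ-OUT face at the assembled species with leaf A3 PRODUCED, box read-out AT ARISING TABLES -/

/-- **THE NE9 END OF RECORD (`…_margProj_fedA3`) WITH `hboxOn`** — VERBATIM re-cut of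
`NE9SizeFedCouplingSpeciesReadOut.termSize_ne9_and_fadingMemory_species_margProj_fedA3` with the box read-out asked only at the
arising tables; conclusion the END of record's, letter for letter.
[cite: Balaban1987RG1, (0.28)-(0.29) p.258, (1.3) p.260, (1.18) p.263, (1.20)-(1.22) p.264, (3.53)-(3.54) p.280, (4.22) p.286; Balaban1988RG2Cluster, (1.23)-(1.29) pp.7-8, (1.33)-(1.36) p.9, (2.14)-(2.15) p.15] -/
theorem termSize_ne9_and_fadingMemory_species_margProj_fedA3_on (G : ClusterGeom (doubleCarriers C₀)) {Pot : Type*}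
    [NormedAddCommGroup Pot] [NormedSpace ℂ Pot] {D : CurData C₀ E ι α β γ δ} {K : KerData C₀ E ι α' β' γ' δ' Pt}
    {ℓg ℓk gain : ℕ → ℕ → ℝ} {cdir cK δ₀ δ₁ w w0 c0 c1 d0 O1 cQa cQb : ℝ}
    {Ef : Functional (doubleCarriers C₀) E} {W : Set (ℕ → ℝ)}
    {Adm MF : Set (E → (doubleCarriers C₀).Dom → ℝ)}
    {r : ℕ → (E → (doubleCarriers C₀).Dom → ℝ) → ℝ} {A : E → (doubleCarriers C₀).Dom → ℝ}
    {Ψ : ℕ → ℝ → (ι → ℝ) → E → (doubleCarriers C₀).Dom → ℝ} {act : ℕ → ℝ → E → Pot → G.P → ℂ} {𝒜 : ℕ → Set Pot}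
    {n : ℕ → ℝ → E → G.P → ℝ} {lip clip : ℕ → ℝ} {a d : G.P → ℝ} {δv : (doubleCarriers C₀).Dom → ℝ}
    {κ B lipbar clipbar qTbar ω cr aA Nbar clipa lam : ℝ} {p₀ N : ℕ → ℝ}
    -- species (a)
    (hD : D.Admissible ℓg cdir d0) (hℓ : ∀ k j, 0 < ℓg k j)
    (hLa : LevelCountsG D.toC.frame κ D.κ₁ O1 cQa (fun k j => ℓg k j ^ 5) (agePow ω))
    (hAa : PieceAdditiveOn (analyticClass D.R) D.toC)
    (hclipa : 0 ≤ clipa) (hcdir : 0 < cdir) (hhalf : ∀ k j, cdir * ℓg k j < 1 / 2)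
    (hcont : ∀ (k : ℕ) (s : ℕ → ℝ) (y : ι) (a : α) (b : β) (x : (doubleCarriers C₀).Dom),
      ContinuousOn (fun q : (ℂ × ((δ → ℝ) × (δ → ℂ))) × ℂ => D.cur k s y a b x q.1.1 q.1.2.1 q.1.2.2 q.2)
        ((sphere (0:ℂ) (D.r k) ×ˢ {q | OnContour D.κ₁ (D.cubes k y a b) q.1 q.2}) ×ˢ sphere (0:ℂ) 1))
    (hlip : ∀ g ∈ W, ∀ g' ∈ W, ∀ (k : ℕ) (y : ι), ∀ a ∈ D.S0 k y, ∀ b ∈ D.SY k y a, ∀ (j : ℕ), ∀ x ∈ D.src k y a j,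
      ∀ t ∈ sphere (0:ℂ) (D.r k), ∀ (s' : δ → ℝ) (σ' : δ → ℂ), OnContour D.κ₁ (D.cubes k y a b) s' σ' →
        ∀ τ ∈ ball (0:ℂ) (1 / (2 * (cdir * ℓg k j))),
          ‖D.cur k g y a b x t s' σ' τ - D.cur k g' y a b x t s' σ' τ‖ ≤ clipa * (D.R x.1 / 2) * |g k - g' k|)
    (hroom : ∀ g ∈ W, ∀ (k : ℕ) (y : ι), ∀ a ∈ D.S0 k y, ∀ b ∈ D.SY k y a, ∀ (j : ℕ), ∀ x ∈ D.src k y a j,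
      ∀ t ∈ sphere (0:ℂ) (D.r k), ∀ (s' : δ → ℝ) (σ' : δ → ℂ), OnContour D.κ₁ (D.cubes k y a b) s' σ' →
        ∀ τ ∈ ball (0:ℂ) (1 / (2 * (cdir * ℓg k j))), ‖D.cur k g y a b x t s' σ' τ‖ ≤ D.R x.1 / 2)
    -- species (b)
    (hK : K.Admissible ℓk gain cK δ₀ δ₁ w w0 c0 c1 d0) (hκ₁ : K.κ₁ = D.κ₁) (hR : K.R = D.R)
    (hdY : K.toC.frame.dY = D.toC.frame.dY)
    (hLb : LevelCountsG K.toC.frame (κ - w) K.κ₁ O1 cQb gain (agePow ω))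
    (hAb : PieceAdditiveOn (analyticClass K.R) K.toC) (hlam : 0 ≤ lam)
    (hkerC : ∀ (k : ℕ) (s : ℕ → ℝ) (y : ι) (a : α') (b : β') (x : (doubleCarriers C₀).Dom), ∀ p ∈ K.pts k y a,
      ∀ q ∈ K.pts k y a, ∀ F : E → ℂ, DifferentiableOn ℂ F (ball 0 (K.R x.1)) →
        Continuous fun wv : ℂ × (δ' → ℝ) × (δ' → ℂ) => K.ker k s y a b x wv.1 wv.2.1 wv.2.2 p q F)
    (hkerL : ∀ g ∈ W, ∀ g' ∈ W, ∀ (k : ℕ) (y : ι), ∀ a ∈ K.S0 k y, ∀ b ∈ K.SY k y a, ∀ (j : ℕ), ∀ x ∈ K.src k y a j,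
      ∀ t ∈ sphere (0:ℂ) (K.r k), ∀ (s' : δ' → ℝ) (σ' : δ' → ℂ), OnContour K.κ₁ (K.cubes k y a b) s' σ' →
        ∀ p ∈ K.pts k y a, ∀ q ∈ K.pts k y a, ∀ (F : E → ℂ) (M : ℝ),
          DifferentiableOn ℂ F (ball 0 (K.R x.1)) → (∀ z ∈ ball (0:E) (K.R x.1), ‖F z‖ ≤ M) →
            ‖K.ker k g y a b x t s' σ' p q F - K.ker k g' y a b x t s' σ' p q F‖ ≤
              cK * lam * M * gain k j * K.ρd p q ^ K.m * Real.exp (-(δ₀ * (K.dX x.1 p + K.dX x.1 q))) * |g k - g' k|)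
    (hO1 : 0 ≤ O1) (hcQa : 0 ≤ cQa) (hcQb : 0 ≤ cQb) (hMF : MF ⊆ analyticClass D.R)
    -- the face's binders (END-M `…_margProj`), at 𝒯 := cpieceChannel D.toC + cpieceChannel K.toC — minus `hTcup` ∕ `hqT0`
    (ρ : ℕ → (ι → ℝ) → Pot) (U₀ : E) (explZ : ℕ → E → (doubleCarriers C₀).Dom → ℝ) (h0 : ScaleZeroFree Ef W)
    (hAdm : AdmissibleTerms Ef W Adm) (hres : AdmRestrict Adm)
    (hrA : ReadAdditive Adm r) (hr0 : ReadZero r) (hrs : ReadSize Adm r κ cr) (hA : DirSize A κ aA) (hcr : 0 ≤ cr)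
    (haA : 0 ≤ aA) (hPinto : ProjInto Adm MF (margProj r A))
    (hfac : Factorises Ef W (compProj (cpieceChannel D.toC + cpieceChannel K.toC) (margProj r A)) Ψ)
    (hclip0 : ∀ k, 0 ≤ clip k)
    (hCup : ∀ g ∈ W, ∀ g' ∈ W, ∀ (k : ℕ) (U : E) (X : (doubleCarriers C₀).Dom), (doubleCarriers C₀).scale X = k + 1 →
      ∀ Q ∈ 𝒜 k, ∀ γ' ∈ G.vol X,
      ‖act k (g k) U Q γ'‖ ≤ n k (g' k) U γ' ∧
        ‖act k (g k) U Q γ' - act k (g' k) U Q γ'‖ ≤ clip k * |g k - g' k| * n k (g' k) U γ')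
    (hreprV : ∀ (k : ℕ) (s : ℝ) (Q : ι → ℝ) (U : E) (X : (doubleCarriers C₀).Dom),
      Ψ k s Q U X = (G.newTerm act k s U X (ρ k Q)).re - (G.newTerm act k s U₀ X (ρ k Q)).re + explZ k U X)
    (hclipb : ∀ k, clip k ≤ clipbar) (hNb : ∀ j, N j ≤ Nbar)
    (hqTb : (64 * clipa * cQa + lam * cQb) * ((1 + cr * aA) * Nbar) * (1 - ω)⁻¹ ≤ qTbar)
    (hKP : TwoPointKP G W act 𝒜 n lip a d) (hdec : G.DecayExtract δv d) (hpin : G.PinBudget a δv (fun _ => B) κ)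
    (hρ : ∀ (k : ℕ) (Q Q' : ι → ℝ) (M : ℝ),
      (∀ y, |Q y - Q' y| ≤ weightOf D.toC.frame D.κ₁ d0 O1 (D.Kp cdir + K.Kp cK w0 c0 c1) k y * M) →
        ‖ρ k Q - ρ k Q'‖ ≤ M)
    (hexplZ : ∀ (k : ℕ) (U : E) (X : (doubleCarriers C₀).Dom), (doubleCarriers C₀).scale X = k + 1 →
      |explZ k U X| ≤ Real.exp (-(κ * (doubleCarriers C₀).d X)) * p₀ k)
    (hbase : ∀ g ∈ W, ∀ (U : E) (X : (doubleCarriers C₀).Dom), (doubleCarriers C₀).scale X = 0 →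
      |Ef g U X| ≤ Real.exp (-(κ * (doubleCarriers C₀).d X)) * N 0)
    (hNsucc : ∀ j, p₀ j + 2 * B ≤ N (j + 1)) (hNnn : ∀ j, 0 ≤ N j)
    (hboxOn : ∀ (k : ℕ), ∀ g ∈ W, ∀ g' ∈ W,
      (∀ y, |compProj (cpieceChannel D.toC + cpieceChannel K.toC) (margProj r A) k g' (Ef g) y| ≤
        weightOf D.toC.frame D.κ₁ d0 O1 (D.Kp cdir + K.Kp cK w0 c0 c1) k y *
          sizeRadius (fun k j => (1 + cr * aA) * (tauOfG cQa (agePow ω) + tauOfG cQb (agePow ω)) k j) N k) →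
      ρ k (compProj (cpieceChannel D.toC + cpieceChannel K.toC) (margProj r A) k g' (Ef g)) ∈ 𝒜 k)
    (hB : 0 ≤ B) (hlipb : ∀ k, lip k ≤ lipbar) (hω : 0 ≤ ω) (hω1 : ω < 1)
    (hpos : 0 < ω + 8 * lipbar * B * ((1 + cr * aA) * (cQa + cQb))) :
    TermSize Ef W κ N ∧
      NE9 Ef W κ (prodModuli (8 * clipbar * B + 8 * lipbar * B * qTbar)
        fun _ => ω + 8 * lipbar * B * ((1 + cr * aA) * (cQa + cQb))) ∧
        FadingMemory ((8 * clipbar * B + 8 * lipbar * B * qTbar) / (ω + 8 * lipbar * B * ((1 + cr * aA) * (cQa + cQb))))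
          (ω + 8 * lipbar * B * ((1 + cr * aA) * (cQa + cQb)))
          (prodModuli (8 * clipbar * B + 8 * lipbar * B * qTbar)
            fun _ => ω + 8 * lipbar * B * ((1 + cr * aA) * (cQa + cQb))) := by
  have hℓg : ∀ k j, 0 ≤ ℓg k j := fun k j => (hℓ k j).le
  have hMFb : MF ⊆ analyticClass K.R := by rw [hR]; exact hMF
  have hsum : ChannelStepSum MF (cpieceChannel D.toC + cpieceChannel K.toC) :=
    channelStepSum_add (channelStepSum_cpiece (pieceZero_cur D) (pieceLocal_cur D) (csrcScale_cur hD) MF)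
      (channelStepSum_cpiece (pieceZero_ker hK.kerZero) (pieceLocal_ker K) (csrcScale_ker hK) MF)
  have ha : ChannelSizeAtStepNN MF (cpieceChannel D.toC) κ (weightOf D.toC.frame D.κ₁ d0 O1 (D.Kp cdir))
      (tauOfG cQa (agePow ω)) :=
    channelSizeAtStepNN_mono hMF
      (channelSizeAtStepNN_cur hD hℓg κ hLa hO1 (fun k j => mul_nonneg hcQa (agePow_nonneg hω k j)))
  have hb : ChannelSizeAtStepNN MF (cpieceChannel K.toC) κ (weightOf K.toC.frame D.κ₁ d0 O1 (K.Kp cK w0 c0 c1))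
      (tauOfG cQb (agePow ω)) := by
    have h := channelSizeAtStepNN_mono hMFb
      (channelSizeAtStepNN_ker hK κ hLb hO1 (fun k j => mul_nonneg hcQb (agePow_nonneg hω k j)))
    rw [hκ₁] at h
    exact h
  have hstep : ChannelSizeAtStepNN MF (cpieceChannel D.toC + cpieceChannel K.toC) κ
      (weightOf D.toC.frame D.κ₁ d0 O1 (D.Kp cdir + K.Kp cK w0 c0 c1))
      (tauOfG cQa (agePow ω) + tauOfG cQb (agePow ω)) :=
    channelSizeAtStepNN_add_cpiece D.toC K.toC hdY ha hb (kp_nonneg hD) (kp_nonneg_ker hK) hO1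
      (fun k j _ => mul_nonneg hcQa (agePow_nonneg hω k j)) (fun k j _ => mul_nonneg hcQb (agePow_nonneg hω k j))
  have hadd : ChannelAdditive MF (cpieceChannel D.toC + cpieceChannel K.toC) :=
    channelAdditive_add (channelAdditive_cpiece (pieceAdditiveOn_mono hMF hAa))
      (channelAdditive_cpiece (pieceAdditiveOn_mono hMFb hAb))
  have hτ := profile_species hcQa hcQb hω
  have hPE : ∀ g ∈ W, margProj r A (Ef g) ∈ analyticClass D.R := fun g hg => hMF (hPinto (Ef g) (hAdm.1 g hg))
  have hNbar : 0 ≤ Nbar := (hNnn 0).trans (hNb 0)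
  have h1ω : 0 < 1 - ω := by linarith
  have hca : 0 ≤ cr * aA := mul_nonneg hcr haA
  have hq0 : 0 ≤ (64 * clipa * cQa + lam * cQb) * ((1 + cr * aA) * Nbar) * (1 - ω)⁻¹ := by positivity
  exact termSize_ne9_and_fadingMemory_margProj_fed_on G ρ U₀ explZ h0 hAdm hres hrA hr0 hrs hA hcr haA hPinto hadd hsum hstep
    hfac hclip0 hCup (qT := fun _ => (64 * clipa * cQa + lam * cQb) * ((1 + cr * aA) * Nbar) * (1 - ω)⁻¹) (fun _ => hq0)
    (tcup_species_proj hres (projScaleComm_margProj Adm A hr0) (projSize_margProj hrs hA hcr) hca hAdm.1 hPE hNnn hNb hD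
      hclipa hcdir hℓ hhalf hcont hlip hroom hLa hK hκ₁ hR hdY hlam hkerC hkerL hLb hO1 hcQa hcQb hω hω1)
    hreprV hclipb (fun _ => hqTb) hKP hdec hpin hρ hexplZ hbase hNsucc hNnn hboxOn hB hlipb (add_nonneg hcQa hcQb) hω hpos
    hτ

end Species

end Summit.QuantumFields.BalabanUV.T4Continuum.NE9SizeFedCouplingSpeciesReadOutOn

end
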